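import Mathlib
import HarnessLib
import Literature.NumberTheory.Transcendental.KZKernelConjectureForms
import Summits.KontsevichZagierPeriods.KontsevichZagierPeriods.Theses.StandardParts

/-!
# Route StandardParts — `SpArcClosureOfSummit` (stmt-KontsevichZagierPeriods-3157)

The summit `KontsevichZagierPeriods` (Kontsevich–Zagier 2001, §1.2, Conjecture 1, in its
two-representation form with KZ-literal rational endpoints) implies the closedness statement
`SpArcClosure` of route StandardParts: if two one-parameter families of integral representations
`R t`, `R' t` are KZ-equivalent for every `t ∈ (0,1)` and their extended-by-zero integrands converge
in `L¹` to those of `r₀`, `r₀'` as `t → 0⁺`, then `r₀ ~ r₀'`.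

Proof (elementary, as announced in the route file):
* `L¹`-convergence of the extended-by-zero integrands gives convergence of the values
  (`|∫ F_t − ∫ F₀| ≤ ∫ |F_t − F₀|`);
* soundness of the calculus (`KZ.Equivalent.value_eq_holds`) gives `(R t).value = (R' t).value`
  for `t ∈ (0,1)`, a right neighbourhood of `0`;
* limits along `𝓝[>] 0` are unique, so `r₀.value = r₀'.value`;
* `kzPeriodConjecture'_iff_isRational` (tree, proved) removes the `IsRational` restriction of the
  summit, so the summit applies to `r₀`, `r₀'`.

The semialgebraicity hypotheses of `SpArcClosure` on the total spaces are not used. This certifies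
that a refutation of `SpArcClosure` refutes the summit.
-/

noncomputable section

namespace Summit.KontsevichZagierPeriods.StandardParts

open Filter Set MeasureTheory Topology
open Literature.NumberTheory.Transcendental

/-- The value of an integral representation is the integral over the whole space of its
extended-by-zero integrand `1_σ · f`. [folklore] -/
theorem integralRep_value_eq_integral_indicator {n : ℕ} (r : KZ.IntegralRep n) :
    r.value = ∫ x, r.domain.indicator r.integrand x := by
  rw [KZ.IntegralRep.value, integral_indicator (KZ.IntegralRep.measurableSet_domain_holds r)]

/-- `L¹`-convergence of the extended-by-zero integrands of a family of integral representations
`R t` to that of `r₀` along a filter `l` gives convergence of the values `(R t).value → r₀.value`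
along `l` (`|∫ F_t − ∫ F₀| ≤ ∫ |F_t − F₀|`). [folklore] -/
theorem tendsto_value_of_tendsto_integral_abs_sub {n : ℕ} {l : Filter ℝ}
    (R : ℝ → KZ.IntegralRep n) (r₀ : KZ.IntegralRep n)
    (h : Tendsto (fun t : ℝ => ∫ x, |(R t).domain.indicator (R t).integrand x -
      r₀.domain.indicator r₀.integrand x|) l (𝓝 0)) :
    Tendsto (fun t => (R t).value) l (𝓝 r₀.value) := by
  rw [tendsto_iff_norm_sub_tendsto_zero]
  refine squeeze_zero_norm' (Eventually.of_forall fun t => ?_) h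
  rw [norm_norm, Real.norm_eq_abs, integralRep_value_eq_integral_indicator,
    integralRep_value_eq_integral_indicator,
    ← integral_sub
      ((integrable_indicator_iff (KZ.IntegralRep.measurableSet_domain_holds _)).mpr (R t).integrableOn)
      ((integrable_indicator_iff (KZ.IntegralRep.measurableSet_domain_holds _)).mpr r₀.integrableOn)]
  exact abs_integral_le_integral_abs

/-- Settles stmt-KontsevichZagierPeriods-3157 (`SpArcClosureOfSummit`, support of route
StandardParts): the Kontsevich–Zagier period conjecture implies closedness of KZ-equivalence at
`L¹`-endpoints of arcs of fibrewise-equivalent representations. `L¹`-convergence gives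
convergence of values, `KZ.Equivalent.value_eq_holds` gives `(R t).value = (R' t).value` on
`(0,1)`, limits along `𝓝[>] 0` are unique, and `kzPeriodConjecture'_iff_isRational` removes the
`IsRational` restriction of the summit. [folklore] -/
theorem spArcClosureOfSummit_proof :
    Summit.KontsevichZagierPeriods.KontsevichZagierPeriods.Theses.StandardParts.SpArcClosureOfSummit := by
  unfold KontsevichZagierPeriods.Theses.StandardParts.SpArcClosureOfSummit
    KontsevichZagierPeriods.Theses.StandardParts.SpArcClosure
  intro hS n m R R' r₀ r₀' _ _ _ _ heq hlim hlim'
  have hP : KZPeriodConjecture' := kzPeriodConjecture'_iff_isRational.mpr hS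
  apply hP
  have h₁ := tendsto_value_of_tendsto_integral_abs_sub R r₀ hlim
  have h₂ := tendsto_value_of_tendsto_integral_abs_sub R' r₀' hlim'
  have h₃ : (fun t => (R t).value) =ᶠ[𝓝[>] (0:ℝ)] fun t => (R' t).value := by
    filter_upwards [Ioo_mem_nhdsGT (zero_lt_one' ℝ)] with t ht
    exact KZ.Equivalent.value_eq_holds (heq t ht)
  exact tendsto_nhds_unique (h₁.congr' h₃) h₂

end Summit.KontsevichZagierPeriods.StandardParts
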